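import Summits.BirchSwinnertonDyer.BirchSwinnertonDyer.Theorems.EisensteinPrimesAnomalousLocalTorsion
import Summits.BirchSwinnertonDyer.BirchSwinnertonDyer.Theorems.EisensteinPrimesResidualLineRigidity
import Literature.NumberTheory.EllipticCurves.SerreInertiaImageBaseChangeProofs
import HarnessLib

/-!
# Route `EisensteinPrimes`, crux 2 `GoodLatticeBDPValue` (stmt-BirchSwinnertonDyer-19032), line `halves`, V20 road
# brick (f), part 3: the MOVER at `v̄` for the good anomalous datum, and the anomalous local package of
# `…AnomalousLocalTorsion` DISCHARGED at `D = D_v̄`, `H = D_v̄ ⊓ Gal(K̄/K_∞)` for every `ℤ_p`-extension `K_∞/K`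

Cell `bsd-eis` (home `run/shared/lean/pub/bsd-eis/`), width seat `bsd-line-x1-p1-w2` gen 3 (`--supports -19032`,
closes nothing). Parts 1–2 (`…AnomalousLocalLine`, `…AnomalousLocalTorsion`) derive KY Prop. 1.3.3 / Lemma 1.3.5's
local statements at a place from ONE element of the decomposition group moving a line of `E[p]`. This file SUPPLIES
that element on the binders of crux 2 (`E/ℚ`, `p` odd, `Anom`, no unramified rational `p`-line, `K` imaginary quadratic
with `p = v v̄` split): §1 over `ℚ` — a rational `p`-line which is NOT unramified at `p` is moved by the inertia group
of EVERY prime of `\bar ℤ` above `p` (conjugacy of the primes above `p`); §2 over `K` — **`exists_mem_inertia_smul_ne`**: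
every `Γ_K`-stable line `Φ ≤ E_K[p]` is moved by some `τ ∈ I_v̄ = GreenbergSelmer.inertia v̄` (pull `Φ` back along the
equivariant `E(ℚ̄) ≃ E_K(K̄)` of `exists_addEquiv_geomPoints_baseChange`; it is rational by w2 gen 2's
`ResidualLineRigidity.isRationalLine_of_forall_restrict_smul_mem`, hence ramified at `p` by the crux hypothesis; the
inertia group of the contraction of `𝔓_{v̄}` is `res(I_v̄)` since `p` splits, as in the tree's transport of Serre's
Prop. 12 (c) `InertiaFixedPoint.isCyclic_and_card_inertia_map_baseChange`); §3 the package at `D = decomp v̄`,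
`H = decompIn (ker κ) v̄`, for EVERY `ℤ_p`-extension `κ` of `K` (no anticyclotomic hypothesis):

* **`natCard_fixedPoints_decompIn_geomTorsion_le`**: `#E_K[p]^{D_v̄ ⊓ ker κ} ≤ p` — `dim_𝔽 H⁰(K_{∞,v̄}, E[p]) ≤ 1`
  (KY Lemma 1.3.5 «`ker(res_{M_f[𝔭]}) ∈ {0, 𝔽}`»);
* **`smul_eq_of_mem_fixedPoints_decompIn_geomTorsion`**: `E_K[p]^{D_v̄ ⊓ ker κ} = E_K[p]^{D_v̄}` — the local tower adds
  no `p`-torsion at `v̄`: `E(K_{∞,v̄})[p] = E(K_v̄)[p] (= E(ℚ_p)[p])`, KY's Case I/II-vs-III indicator;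
* **`fixedPoints_decompIn_geomPrimaryTorsion_finite_or_divisible`**: `E(K_{∞,v̄})[p^∞]` is finite or `p`-divisible
  (KY Prop. 1.3.3 (iii) «cyclic»; its FINITENESS = the tree's Fin_v `LocalTowerTorsionFiniteAt` is NOT claimed);
* **`natCard_ker_kummer_decompIn_le`**: `#ker(H¹(K_{∞,v̄}, E[p]) → H¹(K_{∞,v̄}, E[p^∞])) ≤ p` — the (L)-free local
  input of the E-side Kummer comparison `R_v̄(E_K[p]) ↔ Sel_v̄(E_K[p^∞])[p]` at the anomalous place.

HONEST FRAMING: helper theorems only (0 definitions, 0 named facts, 0 sorry); no summit statement, no BSD / IMC2 / KY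
Thm 1.4.1 (iii) is proved; 0 cells / labels move. References: [KellerYin2024] §1.3 Prop. 1.3.3, Lemma 1.3.5, §1.4
Cases I–III (arXiv:2402.12781v2 TeX L922–960, L1009–1046, L1142–1160); [Serre1972] §1.11 Prop. 11 and Cor.;
[NeukirchANT1999] Ch. I §9 (9.3)–(9.6); [GreenbergVatsal2000] p. 4.
-/

set_option autoImplicit false
-- the route's Theorems namespace repeats the summit name by design (D-0017 nested layout)
set_option linter.dupNamespace false

noncomputable section

open scoped Classical Pointwise

namespace Summit.BirchSwinnertonDyer.BirchSwinnertonDyer.Theorems.AnomalousLocalTorsion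

open NumberField IsDedekindDomain Field WeierstrassCurve Rat.HeightOneSpectrum
  Literature.NumberTheory.EllipticCurves Literature.NumberTheory.EllipticCurves.GreenbergSelmer
  Literature.NumberTheory.EllipticCurves.Rank1Residual Literature.NumberTheory.GaloisRepresentations
  Literature.NumberTheory.EllipticCurves.InertiaFixedPoint
  Summit.BirchSwinnertonDyer.BirchSwinnertonDyer.Theorems.ResidualLineRigidity

/-! ## §1. Over `ℚ`: a ramified rational line is moved by the inertia group of every prime above `p` -/

section Rat

variable {W : WeierstrassCurve ℚ} {p : ℕ} [hp : Fact p.Prime]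

omit hp in
/-- `primesEquiv u = p` for a place `u` of `ℚ` containing the rational prime `p`. [folklore] -/
theorem primesEquiv_eq_of_natCast_mem (hpr : p.Prime) {u : HeightOneSpectrum (𝓞 ℚ)}
    (hu : (p : 𝓞 ℚ) ∈ u.asIdeal) : (primesEquiv u : ℕ) = p := by
  have h1 : natGenerator u ∣ p := by
    rw [natGenerator_dvd_iff]
    have h2 := Ideal.mem_map_of_mem (Rat.IsIntegralClosure.intEquiv (𝓞 ℚ)) hu
    rwa [map_natCast] at h2
  exact (Nat.prime_dvd_prime_iff_eq (prime_natGenerator u) hpr).mp h1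

/-- **A rational `p`-line NOT unramified at `p` is moved by the inertia group of EVERY prime `𝔔` of `\bar ℤ`
above `p`**: the witness prime `𝔓` of `¬ LineUnramifiedAt` is a conjugate `g⁻¹ • 𝔔`, `I_{g𝔓} = g I_𝔓 g⁻¹`, and the
line is `Γ_ℚ`-stable. [cite: NeukirchANT1999, Ch. I §9 (9.4)] [cite: GreenbergVatsal2000, p. 4 («unramified at p»)] -/
theorem exists_mem_inertia_smul_ne_of_not_lineUnramifiedAt {Φ : AddSubgroup (geomTorsion W (p : ℤ))}
    (hΦ : IsRationalLine W p Φ) (hram : ¬ LineUnramifiedAt W p Φ)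
    {u : HeightOneSpectrum (𝓞 ℚ)} (hu : (p : 𝓞 ℚ) ∈ u.asIdeal)
    {𝔔 : Ideal (absIntegers (𝓞 ℚ) ℚ)} (h𝔔 : 𝔔 ∈ u.primesAbove) :
    ∃ σ ∈ 𝔔.inertia (absoluteGaloisGroup ℚ), ∃ P ∈ Φ, σ • P ≠ P := by
  have hpr : p.Prime := hp.out
  unfold LineUnramifiedAt at hram
  push Not at hram
  obtain ⟨v₀, hv₀, 𝔓, h𝔓, σ, hσ, P, hP, hne⟩ := hram
  -- `v₀ = u` (both contain `p`)
  have hv₀u : v₀ = u := primesEquiv.injective (Subtype.ext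
    ((primesEquiv_eq_of_natCast_mem hpr hv₀).trans (primesEquiv_eq_of_natCast_mem hpr hu).symm))
  subst hv₀u
  -- `𝔔 = g • 𝔓`
  obtain ⟨g, hg⟩ := HeightOneSpectrum.exists_smul_eq_of_mem_primesAbove_holds (K := ℚ) (v := v₀) h𝔓 h𝔔
  have hσ' : g * σ * g⁻¹ ∈ 𝔔.inertia (absoluteGaloisGroup ℚ) := by
    rw [← hg]
    refine (HeightOneSpectrum.mem_inertia_smul_absIntegers_iff g _ 𝔓).mpr ?_
    have e1 : g⁻¹ * (g * σ * g⁻¹) * g = σ := by group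
    rw [e1]
    exact hσ
  refine ⟨g * σ * g⁻¹, hσ', g • P, hΦ.2 g P hP, fun h ↦ hne ?_⟩
  rw [mul_smul, mul_smul, inv_smul_smul] at h
  exact smul_left_cancel g h

end Rat

/-! ## §2. Over `K`: every `Γ_K`-stable line of `E_K[p]` is moved by `I_v̄` -/

section BaseChange

variable (W : WeierstrassCurve ℚ) [W.IsElliptic] [W.IsGloballyMinimal] {p : ℕ} [hp : Fact p.Prime]
  {K : Type} [Field K] [NumberField K]

omit [W.IsElliptic] [W.IsGloballyMinimal] hp in
/-- `(p) ⊆ v̄ ∩ ℤ`. [folklore] -/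
theorem natCast_mem_under_rat {w : HeightOneSpectrum (𝓞 K)} (hpw : ((p : ℕ) : 𝓞 K) ∈ w.asIdeal) :
    (p : 𝓞 ℚ) ∈ (w.under (𝓞 ℚ)).asIdeal := by
  rw [HeightOneSpectrum.under_asIdeal, Ideal.under_def, Ideal.mem_comap, map_natCast]
  exact hpw

omit [W.IsElliptic] [W.IsGloballyMinimal] in
/-- **`res(I_v̄) = I_𝔔`** for the contraction `𝔔 = 𝔓_{v̄} ∩ \bar ℤ_ℚ` of the prime of `\bar ℤ_K` cut out by `v̄`, when
`p = v v̄` splits in the imaginary quadratic field `K` (`D_𝔔 ≤ res Γ_K`). The bookkeeping of the tree's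
`isCyclic_and_card_inertia_map_baseChange`, isolated. [cite: NeukirchANT1999, Ch. I §9 (9.3)–(9.6)] -/
theorem map_absGaloisRestrict_inertia_eq_of_split (hK : IsImaginaryQuadratic K)
    {v vbar : HeightOneSpectrum (𝓞 K)} (hpv : ((p : ℕ) : 𝓞 K) ∈ v.asIdeal)
    (hpvbar : ((p : ℕ) : 𝓞 K) ∈ vbar.asIdeal) (hne : vbar ≠ v) :
    (GreenbergSelmer.inertia vbar).map (absGaloisRestrict ℚ K).toMonoidHom =
        ((adicCompletionPrime K vbar).comap (absIntegersMap ℚ K)).inertia (absoluteGaloisGroup ℚ) ∧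
      (adicCompletionPrime K vbar).comap (absIntegersMap ℚ K) ∈ (vbar.under (𝓞 ℚ)).primesAbove := by
  haveI : Algebra.IsQuadraticExtension ℚ K := ⟨hK.1⟩
  set u : HeightOneSpectrum (𝓞 ℚ) := vbar.under (𝓞 ℚ) with hudef
  set 𝔓K : Ideal (absIntegers (𝓞 K) K) := adicCompletionPrime K vbar with h𝔓Kdef
  have hwu : vbar.asIdeal.under (𝓞 ℚ) = u.asIdeal := (HeightOneSpectrum.under_asIdeal (𝓞 ℚ) vbar).symm
  have h𝔔 : 𝔓K.comap (absIntegersMap ℚ K) ∈ u.primesAbove :=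
    comap_absIntegersMap_mem_primesAbove hwu (adicCompletionPrime_mem_primesAbove K vbar)
  have hsplit : ((u.asIdeal).primesOver (𝓞 K)).ncard = Module.finrank ℚ K :=
    ZpExtension.ncard_primesOver_under_eq_finrank_of_ne hK.1 hpvbar hpv hne.symm
  have hD : (𝔓K.comap (absIntegersMap ℚ K)).decompositionSubgroup (absoluteGaloisGroup ℚ) ≤
      (absGaloisRestrict ℚ K).toMonoidHom.range :=
    SorensenPatching.decompositionSubgroup_le_range_of_ncard_primesOver_eq hsplit h𝔔
  have hI : GreenbergSelmer.inertia vbar = 𝔓K.inertia (absoluteGaloisGroup K) :=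
    (inertia_adicCompletionPrime_eq_map_absInertia K vbar).symm
  exact ⟨by rw [hI, map_absGaloisRestrict_inertia_eq 𝔓K hD], h𝔔⟩

/-- **THE MOVER AT `v̄`.** For `E/ℚ` (globally minimal) with an odd good ANOMALOUS Eisenstein prime `p` and no
unramified rational `p`-line, `K` imaginary quadratic with `p = v v̄` split: every `Γ_K`-stable line `Φ ≤ E_K[p]`
(`#Φ = p`) is MOVED by some element of the inertia group `I_v̄ = GreenbergSelmer.inertia v̄ ≤ Γ_K`. Proof: pull `Φ`
back along the equivariant `e : E(ℚ̄) ≃ E_K(K̄)` (`exists_addEquiv_geomPoints_baseChange`); the pull-back is a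
`Γ_K`-stable `p`-line of `E[p](ℚ̄)`, hence rational (`isRationalLine_of_forall_restrict_smul_mem`), hence NOT unramified
at `p`; so the inertia group of the contraction `𝔔` of `𝔓_{v̄}` moves it (§1), and `I_𝔔 = res(I_v̄)`
(`map_absGaloisRestrict_inertia_eq_of_split`). (KY: `φ = ω̃` with `φ|_{G_p} = ω` — «`ω` is ramified», TeX L1043.)
[cite: KellerYin2024, §1.3–1.4 (arXiv:2402.12781v2 TeX L886, L1043, L1066–1081)] [cite: Serre1972, §1.11 Prop. 11 and Cor.] -/
theorem exists_mem_inertia_smul_ne (hp2 : p ≠ 2) (hanom : Anom W p)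
    (hGL : ∀ Φ : AddSubgroup (geomTorsion W (p : ℤ)), IsRationalLine W p Φ → ¬ LineUnramifiedAt W p Φ)
    (hK : IsImaginaryQuadratic K) {v vbar : HeightOneSpectrum (𝓞 K)} (hpv : ((p : ℕ) : 𝓞 K) ∈ v.asIdeal)
    (hpvbar : ((p : ℕ) : 𝓞 K) ∈ vbar.asIdeal) (hne : vbar ≠ v)
    {Φ : AddSubgroup (geomPoints (W.baseChange K))} (hΦle : Φ ≤ geomTorsion (W.baseChange K) (p : ℤ))
    (hΦ : Nat.card Φ = p) (hstab : ∀ (σ : absoluteGaloisGroup K), ∀ P ∈ Φ, σ • P ∈ Φ) :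
    ∃ τ ∈ GreenbergSelmer.inertia vbar, ∃ P ∈ Φ, τ • P ≠ P := by
  have hpr : p.Prime := hp.out
  obtain ⟨e, he⟩ := W.exists_addEquiv_geomPoints_baseChange K
  -- the pulled-back line `Ψ ≤ E[p](ℚ̄)`
  have htors : ∀ P ∈ Φ, e.symm P ∈ geomTorsion W (p : ℤ) := fun P hP ↦ by
    refine (Submodule.mem_torsionBy_iff _ _).mpr ?_
    change (p : ℤ) • e.symm P = 0
    apply e.injective
    rw [map_zsmul, AddEquiv.apply_symm_apply, map_zero]
    exact (Submodule.mem_torsionBy_iff _ _).mp (hΦle hP)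
  set Ψ : AddSubgroup (geomTorsion W (p : ℤ)) :=
    (Φ.comap e.toAddMonoidHom).addSubgroupOf (geomTorsion W (p : ℤ)) with hΨdef
  have hmemΨ : ∀ Q : geomTorsion W (p : ℤ), Q ∈ Ψ ↔ e (Q : geomPoints W) ∈ Φ := fun Q ↦ by
    rw [hΨdef, AddSubgroup.mem_addSubgroupOf, AddSubgroup.mem_comap]
    rfl
  have hΨcard : Nat.card Ψ = p := by
    refine Eq.trans (Nat.card_congr (Equiv.ofBijective (fun Q ↦ (⟨e ((Q : Ψ) : geomTorsion W (p : ℤ)),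
      (hmemΨ _).mp Q.2⟩ : Φ)) ⟨fun a b hab ↦ ?_, fun P ↦ ?_⟩)) hΦ
    · have h := congrArg (fun z : Φ ↦ e.symm (z : geomPoints (W.baseChange K))) hab
      simp only [AddEquiv.symm_apply_apply] at h
      exact Subtype.ext (Subtype.ext h)
    · refine ⟨⟨⟨e.symm (P : geomPoints (W.baseChange K)), htors _ P.2⟩, (hmemΨ _).mpr ?_⟩, ?_⟩
      · change e (e.symm (P : geomPoints (W.baseChange K))) ∈ Φ
        rw [AddEquiv.apply_symm_apply]; exact P.2
      · apply Subtype.ext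
        change e (e.symm (P : geomPoints (W.baseChange K))) = P
        rw [AddEquiv.apply_symm_apply]
  have hstabΨ : ∀ (τ : absoluteGaloisGroup K), ∀ Q ∈ Ψ, absGaloisRestrict ℚ K τ • Q ∈ Ψ := by
    intro τ Q hQ
    rw [hmemΨ] at hQ ⊢
    rw [AddSubgroup.torsionBy.coe_smul, he]
    exact hstab τ _ hQ
  have hrat : IsRationalLine W p Ψ := isRationalLine_of_forall_restrict_smul_mem hp2 hanom hGL hK hΨcard hstabΨ
  have hram : ¬ LineUnramifiedAt W p Ψ := hGL Ψ hrat
  -- the contraction prime `𝔔` of `𝔓_{v̄}` and `res(I_v̄) = I_𝔔`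
  obtain ⟨hres, h𝔔⟩ := map_absGaloisRestrict_inertia_eq_of_split (p := p) hK hpv hpvbar hne
  obtain ⟨σ, hσ, Q, hQ, hσQ⟩ := exists_mem_inertia_smul_ne_of_not_lineUnramifiedAt hrat hram
    (natCast_mem_under_rat (K := K) hpvbar) h𝔔
  rw [← hres] at hσ
  obtain ⟨τ, hτ, hτσ⟩ := Subgroup.mem_map.mp hσ
  refine ⟨τ, hτ, e (Q : geomPoints W), (hmemΨ Q).mp hQ, fun h ↦ hσQ ?_⟩
  apply Subtype.ext
  rw [AddSubgroup.torsionBy.coe_smul]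
  apply e.injective
  have hτσ' : absGaloisRestrict ℚ K τ = σ := hτσ
  rw [← hτσ', he]
  exact h

omit [W.IsGloballyMinimal] in
/-- **A `Γ_K`-stable line of `E_K[p]` exists** at a reducible prime: the base change of a rational `p`-line along
the equivariant `E(ℚ̄) ≃ E_K(K̄)`. [cite: GreenbergVatsal2000, p. 4] -/
theorem exists_stable_line_baseChange (hred : ¬ W.HasIrreducibleModPGaloisRep p) :
    ∃ Φ : AddSubgroup (geomPoints (W.baseChange K)), Φ ≤ geomTorsion (W.baseChange K) (p : ℤ) ∧
      Nat.card Φ = p ∧ ∀ (σ : absoluteGaloisGroup K), ∀ P ∈ Φ, σ • P ∈ Φ := by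
  obtain ⟨Φ₀, hΦ₀⟩ := exists_isRationalLine_of_not_irr W p hred
  obtain ⟨e, he⟩ := W.exists_addEquiv_geomPoints_baseChange K
  set f : geomTorsion W (p : ℤ) →+ geomPoints (W.baseChange K) :=
    e.toAddMonoidHom.comp (geomTorsion W (p : ℤ)).subtype with hfdef
  have hf : Function.Injective f := fun a b hab ↦ Subtype.ext (e.injective hab)
  refine ⟨Φ₀.map f, ?_, ?_, ?_⟩
  · rintro _ ⟨Q, -, rfl⟩
    refine (Submodule.mem_torsionBy_iff _ _).mpr ?_
    change (p : ℤ) • e (Q : geomPoints W) = 0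
    rw [← map_zsmul, show (p : ℤ) • (Q : geomPoints W) = 0 from (Submodule.mem_torsionBy_iff _ _).mp Q.2,
      map_zero]
  · rw [Nat.card_congr (Φ₀.equivMapOfInjective f hf).toEquiv.symm, hΦ₀.1]
  · rintro σ _ ⟨Q, hQ, rfl⟩
    refine ⟨absGaloisRestrict ℚ K σ • Q, hΦ₀.2 _ Q hQ, ?_⟩
    change e (((absGaloisRestrict ℚ K σ • Q : geomTorsion W (p : ℤ))) : geomPoints W) = σ • e (Q : geomPoints W)
    rw [AddSubgroup.torsionBy.coe_smul, he]

end BaseChange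

/-! ## §3. The anomalous local package at `D = D_v̄`, `H = D_v̄ ⊓ Gal(K̄/K_∞)`, for every `ℤ_p`-extension -/

section Package

variable (W : WeierstrassCurve ℚ) [W.IsElliptic] [W.IsGloballyMinimal] {p : ℕ} [hp : Fact p.Prime]
  {K : Type} [Field K] [NumberField K] (κ : ZpExtension K p)

omit hp in
/-- `D_v = GreenbergSelmer.decomp v` is closed (the continuous image of the compact `Γ_{K_v}`). [folklore] -/
theorem isClosed_decomp (v : HeightOneSpectrum (𝓞 K)) :
    IsClosed ((GreenbergSelmer.decomp (K := K) v : Subgroup (absoluteGaloisGroup K)) :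
      Set (absoluteGaloisGroup K)) := by
  haveI : CharZero (v.adicCompletion K) :=
    charZero_of_injective_algebraMap (algebraMap K (v.adicCompletion K)).injective
  rw [GreenbergSelmer.decomp, MonoidHom.coe_range]
  exact isClosed_range_absGaloisRestrict K (v.adicCompletion K)

/-- **`#E_K[p]^{D_v̄ ⊓ ker κ} ≤ p`** on the binders of crux 2 (`p` odd good anomalous, no unramified rational `p`-line,
`K` imaginary quadratic with `p = v v̄` split), for EVERY `ℤ_p`-extension `κ`: `dim_𝔽 H⁰(K_{∞,v̄}, E[p]) ≤ 1` —
KY Lemma 1.3.5's «`ker(res_{M_f[𝔭]}) ∈ {0, 𝔽}`» in the `K_∞`-currency.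
[cite: KellerYin2024, §1.3 Lemma 1.3.5 (arXiv:2402.12781v2 TeX L1009–1013, L1040–1046)] -/
theorem natCard_fixedPoints_decompIn_geomTorsion_le (hp2 : p ≠ 2) (hanom : Anom W p)
    (hGL : ∀ Φ : AddSubgroup (geomTorsion W (p : ℤ)), IsRationalLine W p Φ → ¬ LineUnramifiedAt W p Φ)
    (hK : IsImaginaryQuadratic K) {v vbar : HeightOneSpectrum (𝓞 K)} (hpv : ((p : ℕ) : 𝓞 K) ∈ v.asIdeal)
    (hpvbar : ((p : ℕ) : 𝓞 K) ∈ vbar.asIdeal) (hne : vbar ≠ v) :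
    Nat.card (FixedPoints.addSubgroup (decompIn κ.kerSubgroup vbar)
      (geomTorsion (W.baseChange K) (p : ℤ))) ≤ p := by
  obtain ⟨Φ, hΦle, hΦ, hstab⟩ := exists_stable_line_baseChange W (K := K) hanom.1
  obtain ⟨τ, hτ, P, hP, hτP⟩ := exists_mem_inertia_smul_ne W hp2 hanom hGL hK hpv hpvbar hne hΦle hΦ hstab
  exact natCard_fixedPoints_geomTorsion_le κ (isClosed_decomp vbar) (mem_decompIn_iff κ.kerSubgroup vbar) Φ hΦle
    hΦ (GreenbergSelmer.inertia_le_decomp vbar hτ) (fun Q hQ ↦ hstab τ Q hQ) ⟨P, hP, hτP⟩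

/-- **`E_K[p]^{D_v̄ ⊓ ker κ} = E_K[p]^{D_v̄}`** on the binders of crux 2, for EVERY `ℤ_p`-extension `κ`: the local tower
adds no `p`-torsion at `v̄` — `E(K_{∞,v̄})[p] = E(K_v̄)[p]`, the group whose (non)vanishing is KY's Case I/II vs III.
[cite: KellerYin2024, §1.4 Cases I–III (arXiv:2402.12781v2 TeX L1142–1147)] -/
theorem smul_eq_of_mem_fixedPoints_decompIn_geomTorsion (hp2 : p ≠ 2) (hanom : Anom W p)
    (hGL : ∀ Φ : AddSubgroup (geomTorsion W (p : ℤ)), IsRationalLine W p Φ → ¬ LineUnramifiedAt W p Φ)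
    (hK : IsImaginaryQuadratic K) {v vbar : HeightOneSpectrum (𝓞 K)} (hpv : ((p : ℕ) : 𝓞 K) ∈ v.asIdeal)
    (hpvbar : ((p : ℕ) : 𝓞 K) ∈ vbar.asIdeal) (hne : vbar ≠ v)
    {x : geomTorsion (W.baseChange K) (p : ℤ)}
    (hx : x ∈ FixedPoints.addSubgroup (decompIn κ.kerSubgroup vbar) (geomTorsion (W.baseChange K) (p : ℤ)))
    {d : absoluteGaloisGroup K} (hd : d ∈ GreenbergSelmer.decomp vbar) : d • x = x := by
  obtain ⟨Φ, hΦle, hΦ, hstab⟩ := exists_stable_line_baseChange W (K := K) hanom.1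
  obtain ⟨τ, hτ, P, hP, hτP⟩ := exists_mem_inertia_smul_ne W hp2 hanom hGL hK hpv hpvbar hne hΦle hΦ hstab
  exact smul_eq_of_mem_fixedPoints_geomTorsion κ (isClosed_decomp vbar) (mem_decompIn_iff κ.kerSubgroup vbar) Φ
    hΦle hΦ (GreenbergSelmer.inertia_le_decomp vbar hτ) (fun Q hQ ↦ hstab τ Q hQ) ⟨P, hP, hτP⟩ hx hd

/-- **`E(K_{∞,v̄})[p^∞]` is FINITE OR `p`-DIVISIBLE** on the binders of crux 2, for EVERY `ℤ_p`-extension `κ` (KY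
Prop. 1.3.3 (iii) «cyclic»). Fin_v (finiteness) is not claimed. [cite: KellerYin2024, §1.3 Prop. 1.3.3 (ii)–(iii) (arXiv:2402.12781v2 TeX L922–960)] -/
theorem fixedPoints_decompIn_geomPrimaryTorsion_finite_or_divisible (hp2 : p ≠ 2) (hanom : Anom W p)
    (hGL : ∀ Φ : AddSubgroup (geomTorsion W (p : ℤ)), IsRationalLine W p Φ → ¬ LineUnramifiedAt W p Φ)
    (hK : IsImaginaryQuadratic K) {v vbar : HeightOneSpectrum (𝓞 K)} (hpv : ((p : ℕ) : 𝓞 K) ∈ v.asIdeal)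
    (hpvbar : ((p : ℕ) : 𝓞 K) ∈ vbar.asIdeal) (hne : vbar ≠ v) :
    (FixedPoints.addSubgroup (decompIn κ.kerSubgroup vbar) ((W.baseChange K).geomPrimaryTorsion p) :
        Set ((W.baseChange K).geomPrimaryTorsion p)).Finite ∨
      ∀ x ∈ FixedPoints.addSubgroup (decompIn κ.kerSubgroup vbar) ((W.baseChange K).geomPrimaryTorsion p),
        ∃ y ∈ FixedPoints.addSubgroup (decompIn κ.kerSubgroup vbar) ((W.baseChange K).geomPrimaryTorsion p),
          p • y = x := by
  obtain ⟨Φ, hΦle, hΦ, hstab⟩ := exists_stable_line_baseChange W (K := K) hanom.1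
  obtain ⟨τ, hτ, P, hP, hτP⟩ := exists_mem_inertia_smul_ne W hp2 hanom hGL hK hpv hpvbar hne hΦle hΦ hstab
  exact fixedPoints_geomPrimaryTorsion_finite_or_divisible κ (isClosed_decomp vbar)
    (mem_decompIn_iff κ.kerSubgroup vbar) Φ hΦle hΦ (GreenbergSelmer.inertia_le_decomp vbar hτ)
    (fun Q hQ ↦ hstab τ Q hQ) ⟨P, hP, hτP⟩

/-- **The (L)-free LOCAL KUMMER BOUND at the anomalous place: `#ker(H¹(K_{∞,v̄}, E[p]) → H¹(K_{∞,v̄}, E[p^∞])) ≤ p`**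
on the binders of crux 2, for EVERY `ℤ_p`-extension `κ` (`H = decompIn (ker κ) v̄`, UTD's `resH1Hom` currency). With
x2-p2's residual dévissage and UTD's Kummer comparison this bounds the E-side residual-vs-`p`-torsion defect at `v̄` by
ONE factor `p` instead of hypothesis (L). [cite: KellerYin2024, §1.3 Lemma 1.3.5 and §1.4 Cases I–III (arXiv:2402.12781v2 TeX L1009–1046, L1142–1160)]
[cite: GreenbergLNM1716, §3 proof of Lemma 3.1] -/
theorem natCard_ker_kummer_decompIn_le (hp2 : p ≠ 2) (hanom : Anom W p)
    (hGL : ∀ Φ : AddSubgroup (geomTorsion W (p : ℤ)), IsRationalLine W p Φ → ¬ LineUnramifiedAt W p Φ)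
    (hK : IsImaginaryQuadratic K) {v vbar : HeightOneSpectrum (𝓞 K)} (hpv : ((p : ℕ) : 𝓞 K) ∈ v.asIdeal)
    (hpvbar : ((p : ℕ) : 𝓞 K) ∈ vbar.asIdeal) (hne : vbar ≠ v) :
    Nat.card ((resH1Hom (ContinuousMonoidHom.id (decompIn κ.kerSubgroup vbar))
        (AddSubgroup.inclusion (geomTorsion_le_geomPrimaryTorsion (W.baseChange K) p)) (fun _ _ ↦ rfl) :
          subgroupH1 (decompIn κ.kerSubgroup vbar) (geomTorsion (W.baseChange K) (p : ℤ)) →+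
            subgroupH1 (decompIn κ.kerSubgroup vbar) ((W.baseChange K).geomPrimaryTorsion p)).ker) ≤ p := by
  obtain ⟨Φ, hΦle, hΦ, hstab⟩ := exists_stable_line_baseChange W (K := K) hanom.1
  obtain ⟨τ, hτ, P, hP, hτP⟩ := exists_mem_inertia_smul_ne W hp2 hanom hGL hK hpv hpvbar hne hΦle hΦ hstab
  exact natCard_ker_kummer_le κ (isClosed_decomp vbar) (mem_decompIn_iff κ.kerSubgroup vbar) Φ hΦle hΦ
    (GreenbergSelmer.inertia_le_decomp vbar hτ) (fun Q hQ ↦ hstab τ Q hQ) ⟨P, hP, hτP⟩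

end Package

end Summit.BirchSwinnertonDyer.BirchSwinnertonDyer.Theorems.AnomalousLocalTorsion
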